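/-
Copyright: the b2b-balaban T⁴-continuum CRUX team, row NE7b leaf lineage `t4-ne7b-formalise-leaf-02` (gen 136). Project licence.
-/
import Summits.QuantumFields.BalabanUV.T4Continuum.Spine.NE7b.GaugedTermsCovariance
import Summits.QuantumFields.BalabanUV.T4Continuum.Spine.NE7b.TransportSubLetters
import Summits.QuantumFields.BalabanUV.T4Continuum.Spine.NE7b.FlatFullFormFloorTorus

/-!
# THE LOCAL FLOOR OF THE FULL FORM ON THE TWO-SCALE TORUS FROM ITS LETTERS: `…FullFormSineFloor`'s displayed per-cube binder `hloc`
# (`c_loc·Σ‖h_s·x‖² ≤ Σ_P‖Σ_c R_{P,c}(h_s x)_c‖² + Σ_j‖Σ_c R′_{j,c}(h_s x)_c‖²` — the covariant Lemma 2.4′ per cube, Lemma 5.5's shape) ASSEMBLED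
# from (cov)∕(iso) (`…GaugedTermsCovariance`), (pert) per term (`…TransportSubLetters` + AFPT §3 with a MIXED reference family) and a FLAT floor in the
# terms' own currency (displayed: `…FlatFullFormFloorTorus` HS ∕ `…FlatFullFormFloorTorusOp` op), with `c_loc = c∕2 − δ(τ, τ′)`: the displayed inputs
# that remain are PER-CUBE `U1` GAUGES whose GAUGED transports are `τ`-close to `1` ON THE TERMS MEETING THE CUBE's CUTOFF, and `good ⊆` tree gauge
# (row NE7b, node U5c; residual (R2′) family (2), letter (ℓ1); E-side assembly — [B9] CMP **102** p. 428 «Localizing the operators in `Δ_k` …», the written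
# repair `HOME/b2b-balaban-r1/SectE-interface-proof.md` §5.5 Lemma 5.5, as a tree theorem modulo the local gauges)

Cell `pub-balaban`, sub-cell `t4`, spine estimate NE7b (`T4WeightBudget.RelWeightBound`; the cell's OWN estimate — NOT PRINTED in [Bałaban 1983–89],
NOT PROVED).  Crux-route work under `Spine/NE7b/` by a row leaf (`t4-ne7b-formalise-leaf-02`, E-side ∕ key-readings ∕ lattice-geometry lineage, gen 136)
under FREEZE (0)'s crux-prover clause; [folklore] assembly BY NAME; NOTHING of Bałaban's is asserted; no `def` (families by CTL's ∕ ATL's characterising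
hypotheses; the gauged, flat and mixed families are lambdas INSIDE the proof); zero `sorry`; no `T4Continuum/Support` leaf.
Imports (hub oleans when built; staged on a concat cert otherwise): this lineage's `…FlatFullFormFloorTorus` (FFFT — the tree-gauge vocabulary
`tcls`∕`treeBonds`∕`coarseSites` and the HS discharge of `hflat`), `…GaugedTermsCovariance` (GTC: `full_form_gaugeAct`, `sum_normSq_gaugeAct`;
through it CTL `sum_curlMaps_eq`, ATL `sum_avgMaps_eq`, `B8Ineq132.norm_conjR`) and `…TransportSubLetters` (TSL v2: `norm_curlMap_sub_flat_le`,
`norm_avgMap_sub_flat_le` PER TERM; through it AFPT `half_flat_le_of_linear_terms_two`, ACFS `card_image_four_le`, TPI `card_plaquettes_through_bond_le`,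
TAI `card_image_avgBonds_le` ∕ `card_terms_through_bond_le`, `B7Prop3GeneralLinearBound.norm_conjR_sub_self_le` — [B7] (124)–(126) PROVED).

WHY.  FFSF `ims_floor_full_form` (leaf-02 g135) proved the (h2) slot's IMS floor for the k = 1 full form with EVERY bookkeeping binder a tree theorem and
ONE analytic binder displayed: `hloc`, the local floor of the covariant full form on each localised field `h_s·x` (equivalently AFS2's five letters
(iso)∕(cov)∕(adm)∕(pert)∕(flat) composed by `…AdmissibleFloorSeminormIMS.local_floor_N`).  Its proof in the written repair (Lemma 5.5): gauge the cube so
that the transports of the terms near it are close to `1` ((π4), R-V), compare with the flat form there ((pert), `(x − y)² ≥ ½x² − y²`), apply Lemma 2.4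
((flat)), undo the gauge ((iso)∕(cov)).  THIS FILE is that composition on the two-scale torus with the cell's own objects: GTC supplies (iso)∕(cov) for CTL's
∕ ATL's families under a sitewise gauge; TSL v2 supplies the per-map (pert) sub-letters PER TERM — fed to AFPT §3 with the MIXED reference family (flat on
the terms meeting `supp h_s`, gauged elsewhere, so that `τ` is asked only where the local gauge controls it); the flat floor is a DISPLAYED binder `hflat`
in the terms' own currency (discharged by FFFT in the Hilbert–Schmidt currency, by FFFTO §2 at price `|m|` in the operator currency of `M_m(ℂ)` —
Q-leaf05-g157-1 is the consumer's to rule, not this file's); (adm) is PROVED (cutoffs and conjugations preserve the tree gauge).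

WHAT IS PROVED ([folklore]; `𝔸` normed ℂ-algebra, `‖1‖ = 1`; CTL's `ι`∕`hι`∕`w`∕`hR`, ATL's `ιA`∕`ω`∕`w′`∕`hR′` VERBATIM on `ZMod (n·M)`; cubes indexed by ANY
type `ιS` with real cutoffs `h : ιS → bonds → ℝ`; per-cube sitewise gauges `g s : sites → 𝔸ˣ` in `U1`; gauged transports CHARACTERISED:
`wg s P i = g s (ι P 0)₋ · w P i · (g s (ι P (i+1))₋)⁻¹`, `wg′ s j rt = g s (b_j) · w′ j rt · (g s (ιA j rt)₋)⁻¹` (any base points `b`)):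
* §1 `conjR_cutoff_eq_zero`, `sum_maps_eq_zero_of_vanish`, **`treeGauge_gaugedCutoff`** ((adm): the tree gauge survives cutoff + conjugation).
* §2 **`local_floor_torus`** — DISPLAYED: `hflat : ∀ Y, treeGauge Y → c·Σ‖Y c‖² ≤ Σ_P‖Y(ι P 0) + Y(ι P 1) − Y(ι P 2) − Y(ι P 3)‖² + Σ_j‖ω • Σ_{rt} Y(ιA j rt)‖²`
  (the flat floor in `𝔸`'s currency), `hg : g s y ∈ U1`, `hτ : ∀ s P, (∃ c ∈ image(ι P), h s c ≠ 0) → ∀ i, ‖wg s P i − 1‖ ≤ τ`, `hτ′` (the same for the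
  average terms meeting the cutoff), `0 ≤ τ, τ′`, `hgood : good x → treeGauge x`.  CONCLUSION — FFSF's `hloc` VERBATIM with
  `c_loc = c∕2 − ((2τ)²·4·2(d−1) + (2τ′(|ω|n))²·n^{d+1}·n)`:
  `∀ s x, good x → c_loc·Σ_c‖h s c • x c‖² ≤ Σ_P‖Σ_{c∈image(ι P)} R_{P,c}(h s c • x c)‖² + Σ_j‖Σ_{c∈image(ιA j)} R′_{j,c}(h s c • x c)‖²`.
(No toy: as for FFSF ∕ FFSP, the statement is its own smallest instance worth reading; GTC and TSL carry the toys of the letters.)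

NOT HERE (honest): the local gauges BY VALUE — (π4) ∕ R-V: `…LocalGaugeTransportSize` gives `‖V₀^{g}(x,μ) − 1‖ ≤ |x − y₀|₁α₀` in the axial gauge at `y₀`
and the block-averaged transports' sizes, so `τ_s = O((L + margins)·α₀)` on the terms meeting a cube of side `L` («`Mα₀` sufficiently small», p. 428) —
OWNER ∕ (A3) choose the gauges and the window; the identification `wg = ` holonomies of `V₀^{g}` ((11), CCTL's `bavg_gaugeAct` road); `hflat`'s discharge
(FFFT ∕ FFFTO — the currency ruling Q-leaf05-g157-1); the IMS assembly itself (FFSF ∕ FFSP ∕ FFSQ BY NAME with `hloc := local_floor_torus …`);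
`k > 1`; anything of Bałaban's beyond the cited PROVED letters.  BY-NAME EFFECT ON THE WALL: NONE (the wall is (R2); this removes FFSF's displayed
`hloc` in favour of per-cube gauge smallness + a flat floor letter).  NE7b NOT PRINTED ∕ NOT PROVED; spine PROVED 0∕9; rung (B)+1 on ONE finite T⁴ —
NOT infinite volume, NOT the mass gap, NOT Clay.
HONEST DEPENDENCY: continuum YM on T⁴ ⇐ BetaPertH ∧ nine spine estimates (0/9 proved); BetaPertH ⇐ (D1) ∧ (D4) ∧ CAP+tail; G-an2-4 gates asym, D1 and NE2/3/4.
-/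

set_option autoImplicit false

noncomputable section

open Finset
open Literature.MathematicalPhysics.QuantumFieldTheory.Balaban1983to89.B7Prop1Explicit (U1)
open Literature.MathematicalPhysics.QuantumFieldTheory.Balaban1983to89.B7Eq78Linearization (conjR conjR_apply conjR_add conjR_sub conjR_smul_real)
open Literature.MathematicalPhysics.QuantumFieldTheory.Balaban1983to89.B8Ineq132 (conjR_conjR norm_conjR)
open Literature.MathematicalPhysics.QuantumFieldTheory.Balaban1983to89.T4TermwiseTorus (tcls)
open Literature.MathematicalPhysics.QuantumFieldTheory.Balaban1983to89.B6BondElimination (treeBonds)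
open Literature.MathematicalPhysics.QuantumFieldTheory.Balaban1983to89.B6Lemma24Torus (coarseSites)
open Summit.QuantumFields.BalabanUV.T4Continuum.NE7b.CurlTermsLinear (sum_curlMaps_eq)
open Summit.QuantumFields.BalabanUV.T4Continuum.NE7b.AverageTermsLinear (sum_avgMaps_eq)
open Summit.QuantumFields.BalabanUV.T4Continuum.NE7b.TorusPlaquetteIncidence (card_plaquettes_through_bond_le)
open Summit.QuantumFields.BalabanUV.T4Continuum.NE7b.AveragedCurlFormSplit (card_image_four_le)
open Summit.QuantumFields.BalabanUV.T4Continuum.NE7b.TorusAverageIncidence (card_image_avgBonds_le card_terms_through_bond_le)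
open Summit.QuantumFields.BalabanUV.T4Continuum.NE7b.AdmissibleFloorPerturbationTerms (half_flat_le_of_linear_terms_two)
open Summit.QuantumFields.BalabanUV.T4Continuum.NE7b.TransportSubLetters (norm_curlMap_sub_flat_le norm_avgMap_sub_flat_le)
open Summit.QuantumFields.BalabanUV.T4Continuum.NE7b.GaugedTermsCovariance (full_form_gaugeAct sum_normSq_gaugeAct)

namespace Summit.QuantumFields.BalabanUV.T4Continuum.NE7b.LocalFloorTorus

variable {d M : ℕ} (n : ℕ)
variable {𝔸 : Type*} [NormedRing 𝔸] [NormedAlgebra ℂ 𝔸] [NormOneClass 𝔸]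

/-! ## §1 Small letters: vanishing cutoffs, vanishing terms, the tree gauge survives cutoff and conjugation -/

omit [NormOneClass 𝔸] in
/-- Where the cutoff vanishes, the gauged localised field vanishes: `h = 0 ⊢ R(u)(h • v) = 0`. [folklore] -/
theorem conjR_cutoff_eq_zero (u : 𝔸ˣ) {hc : ℝ} (h0 : hc = 0) (v : 𝔸) : conjR u (hc • v) = 0 := by
  rw [h0, zero_smul, conjR_apply, mul_zero, zero_mul]

omit [NormOneClass 𝔸] in
/-- A term all of whose bonds carry the zero field reads zero, whatever its maps. [folklore] -/
theorem sum_maps_eq_zero_of_vanish {C : Type*} (inc : Finset C) (T : C → 𝔸 →ₗ[ℝ] 𝔸) (Y : C → 𝔸) (hY : ∀ c ∈ inc, Y c = 0) :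
    ∑ c ∈ inc, T c (Y c) = 0 :=
  Finset.sum_eq_zero fun c hc => by rw [hY c hc, map_zero]

omit [NormOneClass 𝔸] in
/-- **(adm)**: the tree gauge survives a real cutoff followed by a sitewise conjugation. [folklore] -/
theorem treeGauge_gaugedCutoff {ιS : Type*} (h : ιS → (Fin d → ZMod (n * M)) × Fin d → ℝ)
    (g : ιS → (Fin d → ZMod (n * M)) → 𝔸ˣ) (s : ιS) (x : (Fin d → ZMod (n * M)) × Fin d → 𝔸)
    (hx : ∀ y ∈ coarseSites n (fun _ : Fin d => n * M), ∀ bd ∈ treeBonds n y, x (tcls (n * M) bd.1, bd.2) = 0) :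
    ∀ y ∈ coarseSites n (fun _ : Fin d => n * M), ∀ bd ∈ treeBonds n y,
      (fun c => conjR (g s c.1) (h s c • x c)) (tcls (n * M) bd.1, bd.2) = 0 := by
  intro y hy bd hbd
  show conjR _ (h s _ • x _) = 0
  rw [hx y hy bd hbd, smul_zero, conjR_apply, mul_zero, zero_mul]

/-! ## §2 The local floor assembled -/

/-- **THE LOCAL FLOOR OF THE FULL FORM ON THE TORUS** — FFSF's `hloc` with `c_loc = c∕2 − ((2τ)²·4·2(d−1) + (2τ′(|ω|n))²·n^{d+1}·n)` from: the flat
floor `hflat` in the terms' currency (displayed), per-cube `U1` gauges `g s` whose GAUGED transports (`hwg*`, `hwg'`) are `τ`∕`τ′`-close to `1` on the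
terms meeting the cutoff `h s` (displayed), and `good ⊆` tree gauge.  Composition: (cov)∕(iso) GTC; (pert) TSL v2 per term + AFPT §3 on the mixed
reference family; (flat) `hflat` on the gauged localised field, whose tree gauge is §1. [folklore] -/
theorem local_floor_torus [NeZero n] [NeZero M] [NeZero (n * M)] [Fact (1 < n * M)]
    -- the curl family (CTL ∕ TPI)
    (ι : (Fin d → ZMod (n * M)) × {a : Fin d × Fin d // a.1 < a.2} → Fin 4 → (Fin d → ZMod (n * M)) × Fin d)
    (hι : ∀ x a, ι (x, a) = ![(x, a.1.1), (x + Pi.single a.1.1 1, a.1.2), (x + Pi.single a.1.2 1, a.1.1), (x, a.1.2)])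
    (w : (Fin d → ZMod (n * M)) × {a : Fin d × Fin d // a.1 < a.2} → Fin 3 → 𝔸ˣ) (hw : ∀ P i, w P i ∈ U1 𝔸)
    (R : (Fin d → ZMod (n * M)) × {a : Fin d × Fin d // a.1 < a.2} → (Fin d → ZMod (n * M)) × Fin d → 𝔸 →ₗ[ℝ] 𝔸)
    (hR : ∀ P c, R P c =
        if c = ι P 0 then LinearMap.id
        else if c = ι P 1 then LinearMap.mk ⟨conjR (w P 0), conjR_add (w P 0)⟩ (conjR_smul_real (w P 0))
        else if c = ι P 2 then -LinearMap.mk ⟨conjR (w P 1), conjR_add (w P 1)⟩ (conjR_smul_real (w P 1))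
        else if c = ι P 3 then -LinearMap.mk ⟨conjR (w P 2), conjR_add (w P 2)⟩ (conjR_smul_real (w P 2))
        else 0)
    -- the average family (ATL ∕ TAI)
    (ιA : (Fin d → ZMod M) × Fin d → (Fin d → Fin n) × Fin n → (Fin d → ZMod (n * M)) × Fin d)
    (hιA : ∀ y κ r t, ιA (y, κ) (r, t) =
      ((fun i => (((y i).val * n + (r i : ℕ) : ℕ) : ZMod (n * M))) + Pi.single κ ((t : ℕ) : ZMod (n * M)), κ))
    (ω : ℝ) (w' : (Fin d → ZMod M) × Fin d → (Fin d → Fin n) × Fin n → 𝔸ˣ) (hw' : ∀ j rt, w' j rt ∈ U1 𝔸)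
    (R' : (Fin d → ZMod M) × Fin d → (Fin d → ZMod (n * M)) × Fin d → 𝔸 →ₗ[ℝ] 𝔸)
    (hR' : ∀ j c, R' j c = ω • ∑ rt ∈ Finset.univ.filter (fun rt => ιA j rt = c),
        LinearMap.mk ⟨conjR (w' j rt), conjR_add (w' j rt)⟩ (conjR_smul_real (w' j rt)))
    -- DISPLAYED: the flat floor in the terms' own currency
    {c : ℝ}
    (hflat : ∀ Y : (Fin d → ZMod (n * M)) × Fin d → 𝔸,
      (∀ y ∈ coarseSites n (fun _ : Fin d => n * M), ∀ bd ∈ treeBonds n y, Y (tcls (n * M) bd.1, bd.2) = 0) →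
      c * ∑ c', ‖Y c'‖ ^ 2 ≤ ∑ P, ‖Y (ι P 0) + Y (ι P 1) - Y (ι P 2) - Y (ι P 3)‖ ^ 2 + ∑ j, ‖ω • ∑ rt, Y (ιA j rt)‖ ^ 2)
    -- the cubes: cutoffs, DISPLAYED local gauges and their gauged transports, DISPLAYED smallness on the terms meeting the cutoff
    {ιS : Type*} (h : ιS → (Fin d → ZMod (n * M)) × Fin d → ℝ)
    (g : ιS → (Fin d → ZMod (n * M)) → 𝔸ˣ) (hg : ∀ s y, g s y ∈ U1 𝔸)
    (wg : ιS → (Fin d → ZMod (n * M)) × {a : Fin d × Fin d // a.1 < a.2} → Fin 3 → 𝔸ˣ)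
    (hwg0 : ∀ s P, wg s P 0 = g s (ι P 0).1 * w P 0 * (g s (ι P 1).1)⁻¹)
    (hwg1 : ∀ s P, wg s P 1 = g s (ι P 0).1 * w P 1 * (g s (ι P 2).1)⁻¹)
    (hwg2 : ∀ s P, wg s P 2 = g s (ι P 0).1 * w P 2 * (g s (ι P 3).1)⁻¹)
    (base : (Fin d → ZMod M) × Fin d → (Fin d → ZMod (n * M)))
    (wg' : ιS → (Fin d → ZMod M) × Fin d → (Fin d → Fin n) × Fin n → 𝔸ˣ)
    (hwg' : ∀ s j rt, wg' s j rt = g s (base j) * w' j rt * (g s (ιA j rt).1)⁻¹)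
    {τ τ' : ℝ} (hτ0 : 0 ≤ τ) (hτ0' : 0 ≤ τ')
    (hτ : ∀ s P, (∃ c' ∈ Finset.univ.image (ι P), h s c' ≠ 0) → ∀ i, ‖(wg s P i : 𝔸) - 1‖ ≤ τ)
    (hτ' : ∀ s j, (∃ c' ∈ Finset.univ.image (ιA j), h s c' ≠ 0) → ∀ rt, ‖(wg' s j rt : 𝔸) - 1‖ ≤ τ')
    -- admissibility
    (good : ((Fin d → ZMod (n * M)) × Fin d → 𝔸) → Prop)
    (hgood : ∀ x, good x → ∀ y ∈ coarseSites n (fun _ : Fin d => n * M), ∀ bd ∈ treeBonds n y, x (tcls (n * M) bd.1, bd.2) = 0) :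
    ∀ (s : ιS) (x : (Fin d → ZMod (n * M)) × Fin d → 𝔸), good x →
      (c / 2 - ((2 * τ) ^ 2 * (4 : ℕ) * (2 * (d - 1) : ℕ) + (2 * τ' * (|ω| * n)) ^ 2 * (n ^ (d + 1) : ℕ) * (n : ℕ)))
          * ∑ c', ‖h s c' • x c'‖ ^ 2
        ≤ ∑ P, ‖∑ c' ∈ Finset.univ.image (ι P), R P c' (h s c' • x c')‖ ^ 2
          + ∑ j, ‖∑ c' ∈ Finset.univ.image (ιA j), R' j c' (h s c' • x c')‖ ^ 2 := by
  classical
  intro s x hx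
  have hn : 0 < n := Nat.pos_of_ne_zero (NeZero.ne n)
  -- the gauged localised field and the three families built inside the proof
  set Y : (Fin d → ZMod (n * M)) × Fin d → 𝔸 := fun c' => conjR (g s c'.1) (h s c' • x c') with hYdef
  let Lmk : 𝔸ˣ → 𝔸 →ₗ[ℝ] 𝔸 := fun u => LinearMap.mk ⟨conjR u, conjR_add u⟩ (conjR_smul_real u)
  let Rg : (Fin d → ZMod (n * M)) × {a : Fin d × Fin d // a.1 < a.2} → (Fin d → ZMod (n * M)) × Fin d → 𝔸 →ₗ[ℝ] 𝔸 :=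
    fun P c' => if c' = ι P 0 then LinearMap.id else if c' = ι P 1 then Lmk (wg s P 0)
      else if c' = ι P 2 then -Lmk (wg s P 1) else if c' = ι P 3 then -Lmk (wg s P 2) else 0
  let R1 : (Fin d → ZMod (n * M)) × {a : Fin d × Fin d // a.1 < a.2} → (Fin d → ZMod (n * M)) × Fin d → 𝔸 →ₗ[ℝ] 𝔸 :=
    fun P c' => if c' = ι P 0 then LinearMap.id else if c' = ι P 1 then Lmk 1
      else if c' = ι P 2 then -Lmk 1 else if c' = ι P 3 then -Lmk 1 else 0
  let R0 : (Fin d → ZMod (n * M)) × {a : Fin d × Fin d // a.1 < a.2} → (Fin d → ZMod (n * M)) × Fin d → 𝔸 →ₗ[ℝ] 𝔸 :=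
    fun P c' => if (∃ c'' ∈ Finset.univ.image (ι P), h s c'' ≠ 0) then R1 P c' else Rg P c'
  let Rg' : (Fin d → ZMod M) × Fin d → (Fin d → ZMod (n * M)) × Fin d → 𝔸 →ₗ[ℝ] 𝔸 :=
    fun j c' => ω • ∑ rt ∈ Finset.univ.filter (fun rt => ιA j rt = c'), Lmk (wg' s j rt)
  let R1' : (Fin d → ZMod M) × Fin d → (Fin d → ZMod (n * M)) × Fin d → 𝔸 →ₗ[ℝ] 𝔸 :=
    fun j c' => ω • ∑ _rt ∈ Finset.univ.filter (fun rt => ιA j rt = c'), Lmk 1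
  let R0' : (Fin d → ZMod M) × Fin d → (Fin d → ZMod (n * M)) × Fin d → 𝔸 →ₗ[ℝ] 𝔸 :=
    fun j c' => if (∃ c'' ∈ Finset.univ.image (ιA j), h s c'' ≠ 0) then R1' j c' else Rg' j c'
  have hRg : ∀ P c', Rg P c' =
      if c' = ι P 0 then LinearMap.id
      else if c' = ι P 1 then LinearMap.mk ⟨conjR (wg s P 0), conjR_add (wg s P 0)⟩ (conjR_smul_real (wg s P 0))
      else if c' = ι P 2 then -LinearMap.mk ⟨conjR (wg s P 1), conjR_add (wg s P 1)⟩ (conjR_smul_real (wg s P 1))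
      else if c' = ι P 3 then -LinearMap.mk ⟨conjR (wg s P 2), conjR_add (wg s P 2)⟩ (conjR_smul_real (wg s P 2))
      else 0 := fun _ _ => rfl
  have hR1 : ∀ P c', R1 P c' =
      if c' = ι P 0 then LinearMap.id
      else if c' = ι P 1 then LinearMap.mk ⟨conjR (1 : 𝔸ˣ), conjR_add 1⟩ (conjR_smul_real 1)
      else if c' = ι P 2 then -LinearMap.mk ⟨conjR (1 : 𝔸ˣ), conjR_add 1⟩ (conjR_smul_real 1)
      else if c' = ι P 3 then -LinearMap.mk ⟨conjR (1 : 𝔸ˣ), conjR_add 1⟩ (conjR_smul_real 1)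
      else 0 := fun _ _ => rfl
  have hRg' : ∀ j c', Rg' j c' = ω • ∑ rt ∈ Finset.univ.filter (fun rt => ιA j rt = c'),
      LinearMap.mk ⟨conjR (wg' s j rt), conjR_add (wg' s j rt)⟩ (conjR_smul_real (wg' s j rt)) := fun _ _ => rfl
  have hR1' : ∀ j c', R1' j c' = ω • ∑ _rt ∈ Finset.univ.filter (fun rt => ιA j rt = c'),
      LinearMap.mk ⟨conjR (1 : 𝔸ˣ), conjR_add 1⟩ (conjR_smul_real 1) := fun _ _ => rfl
  -- the gauged transports are in `U1`
  have hwgU : ∀ P i, wg s P i ∈ U1 𝔸 := by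
    intro P i
    obtain ⟨y', hy'⟩ : ∃ y', wg s P i = g s (ι P 0).1 * w P i * (g s y')⁻¹ := by
      fin_cases i
      exacts [⟨_, hwg0 s P⟩, ⟨_, hwg1 s P⟩, ⟨_, hwg2 s P⟩]
    rw [hy']
    exact (U1 𝔸).mul_mem ((U1 𝔸).mul_mem (hg s _) (hw P i)) ((U1 𝔸).inv_mem (hg s _))
  have hwg'U : ∀ j rt, wg' s j rt ∈ U1 𝔸 := fun j rt => by
    rw [hwg']; exact (U1 𝔸).mul_mem ((U1 𝔸).mul_mem (hg s _) (hw' j rt)) ((U1 𝔸).inv_mem (hg s _))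
  -- where the cutoff vanishes on a whole term, the gauged localised field vanishes on it
  have hYP : ∀ P, ¬ (∃ c'' ∈ Finset.univ.image (ι P), h s c'' ≠ 0) → ∀ c' ∈ Finset.univ.image (ι P), Y c' = 0 := by
    intro P hP c' hc'
    by_contra hne
    exact hP ⟨c', hc', fun h0 => hne (conjR_cutoff_eq_zero _ h0 _)⟩
  have hYj : ∀ j, ¬ (∃ c'' ∈ Finset.univ.image (ιA j), h s c'' ≠ 0) → ∀ c' ∈ Finset.univ.image (ιA j), Y c' = 0 := by
    intro j hj c' hc'
    by_contra hne
    exact hj ⟨c', hc', fun h0 => hne (conjR_cutoff_eq_zero _ h0 _)⟩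
  -- (cov): the full form at the localised field = the gauged full form at the gauged localised field
  have hcov : ∑ P, ‖∑ c' ∈ Finset.univ.image (ι P), R P c' (h s c' • x c')‖ ^ 2
        + ∑ j, ‖∑ c' ∈ Finset.univ.image (ιA j), R' j c' (h s c' • x c')‖ ^ 2
      = ∑ P, ‖∑ c' ∈ Finset.univ.image (ι P), Rg P c' (Y c')‖ ^ 2
        + ∑ j, ‖∑ c' ∈ Finset.univ.image (ιA j), Rg' j c' (Y c')‖ ^ 2 :=
    (full_form_gaugeAct n ι hι w R hR ιA ω w' R' hR' (g s) (hg s) base (wg s) (hwg0 s) (hwg1 s) (hwg2 s) Rg hRg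
      (wg' s) (hwg' s) Rg' hRg' (fun c' => h s c' • x c')).symm
  -- (pert): AFPT §3 with the mixed reference family, TSL v2 per term
  have hRR₁ : ∀ P, ∀ c' ∈ Finset.univ.image (ι P), ∀ v, ‖Rg P c' v - R0 P c' v‖ ≤ 2 * τ * ‖v‖ := by
    intro P c' _ v
    by_cases hP : ∃ c'' ∈ Finset.univ.image (ι P), h s c'' ≠ 0
    · have e : R0 P c' = R1 P c' := if_pos hP
      rw [e]
      exact norm_curlMap_sub_flat_le ι (wg s) hwgU Rg hRg R1 hR1 P (hτ s P hP) c' v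
    · have e : R0 P c' = Rg P c' := if_neg hP
      rw [e, sub_self, norm_zero]
      positivity
  have hRR₂ : ∀ j, ∀ c' ∈ Finset.univ.image (ιA j), ∀ v, ‖Rg' j c' v - R0' j c' v‖ ≤ (2 * τ' * (|ω| * n)) * ‖v‖ := by
    intro j c' _ v
    by_cases hj : ∃ c'' ∈ Finset.univ.image (ιA j), h s c'' ≠ 0
    · have e : R0' j c' = R1' j c' := if_pos hj
      rw [e]
      exact norm_avgMap_sub_flat_le n hn ιA hιA ω (wg' s) hwg'U Rg' hRg' R1' hR1' j (hτ' s j hj) c' v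
    · have e : R0' j c' = Rg' j c' := if_neg hj
      rw [e, sub_self, norm_zero]
      positivity
  have hpert := half_flat_le_of_linear_terms_two (fun P => Finset.univ.image (ι P)) Rg R0 hRR₁
    (fun P => card_image_four_le (ι P)) (fun c' => card_plaquettes_through_bond_le ι hι c')
    (fun j => Finset.univ.image (ιA j)) Rg' R0' hRR₂
    (fun j => card_image_avgBonds_le n ιA j) (fun c' => card_terms_through_bond_le n ιA hιA hn c') Y
  -- the mixed family reads the FLAT form at the gauged localised field
  have hflat₁ : ∀ P, ∑ c' ∈ Finset.univ.image (ι P), R0 P c' (Y c') = Y (ι P 0) + Y (ι P 1) - Y (ι P 2) - Y (ι P 3) := by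
    intro P
    by_cases hP : ∃ c'' ∈ Finset.univ.image (ι P), h s c'' ≠ 0
    · have e : ∀ c', R0 P c' = R1 P c' := fun c' => if_pos hP
      simp only [e]
      rw [sum_curlMaps_eq ι hι (fun _ _ => (1 : 𝔸ˣ)) R1 hR1 P Y]
      simp only [conjR_apply, Units.val_one, inv_one, one_mul, mul_one]
    · have e : ∀ c', R0 P c' = Rg P c' := fun c' => if_neg hP
      simp only [e]
      have h0 := hYP P hP
      rw [sum_maps_eq_zero_of_vanish _ _ Y h0,
        h0 _ (Finset.mem_image_of_mem _ (Finset.mem_univ _)), h0 _ (Finset.mem_image_of_mem _ (Finset.mem_univ _)),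
        h0 _ (Finset.mem_image_of_mem _ (Finset.mem_univ _)), h0 _ (Finset.mem_image_of_mem _ (Finset.mem_univ _))]
      simp
  have hflat₂ : ∀ j, ∑ c' ∈ Finset.univ.image (ιA j), R0' j c' (Y c') = ω • ∑ rt, Y (ιA j rt) := by
    intro j
    by_cases hj : ∃ c'' ∈ Finset.univ.image (ιA j), h s c'' ≠ 0
    · have e : ∀ c', R0' j c' = R1' j c' := fun c' => if_pos hj
      simp only [e]
      rw [sum_avgMaps_eq n ιA ω (fun _ _ => (1 : 𝔸ˣ)) R1' hR1' j Y]
      simp only [conjR_apply, Units.val_one, inv_one, one_mul, mul_one]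
    · have e : ∀ c', R0' j c' = Rg' j c' := fun c' => if_neg hj
      simp only [e]
      have h0 := hYj j hj
      rw [sum_maps_eq_zero_of_vanish _ _ Y h0]
      rw [Finset.sum_eq_zero (fun rt _ => h0 _ (Finset.mem_image_of_mem _ (Finset.mem_univ rt))), smul_zero]
  -- (flat) on the gauged localised field (tree gauge by §1) and (iso)
  have hT := treeGauge_gaugedCutoff n h g s x (hgood x hx)
  have hfl := hflat Y hT
  have hiso : ∑ c', ‖Y c'‖ ^ 2 = ∑ c', ‖h s c' • x c'‖ ^ 2 :=
    sum_normSq_gaugeAct (fun c' : (Fin d → ZMod (n * M)) × Fin d => c'.1) (g s) (hg s) _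
  -- assembly
  simp only [hflat₁, hflat₂] at hpert
  rw [hcov, ← hiso]
  have hN : 0 ≤ ∑ c', ‖Y c'‖ ^ 2 := Finset.sum_nonneg fun _ _ => by positivity
  nlinarith [hpert, hfl, hN]

end Summit.QuantumFields.BalabanUV.T4Continuum.NE7b.LocalFloorTorus

end
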